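import Summits.HubbardSuperconductivity.HubbardSuperconductivity.Theorems.AnisotropyChordTransferFibre3TwoHoleBSMargin
import Mathlib.NumberTheory.Harmonic.Bounds
import Mathlib.Analysis.SpecialFunctions.Pow.Asymptotics

/-!
# Route `AnisotropyChord` / H0 rotor rung: the HONEST near-pair HOLE₂(.75) certificate for ALL LARGE `L` from three satisfiable `L`-free skeleton facts

Twelfth file of the `TwoHoleBS` (PROP BS) chain (memo ROTOR-THEORY-21 §317(b),(d)).  Corollary of the explicit-threshold form
`…Fibre3TwoHoleBSMargin.dualCert_threeQuarter_near_of_gap`: the lifted margin `m(4H_{⌊L/2⌋}) ≳ g/(32(g + ‖x_B‖²/s)(1 + ln L))`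
beats the error `ε(L,d)·K = O(1/L)` for all large `L`:
* `tendsto_one_add_log_sq_div` (`(1 + ln M)²/M → 0`), `tendsto_errCoeff_mul_log` (`ε(M,d)·(1 + ln M) → 0`);
* ★★★ `dualCert_threeQuarter_near_eventually_of_gap`: for `|d|₁ ≥ 2`, if `skelA d` is invertible, `s > 0` and `P∞ ≥ g > 0` on
  zero-sum boundary vectors, then `∃ L₀ ∀ L ≥ L₀ ∀ z, DualCert L (¾ε₁) z (z + d)` — the replacement of p2 g2's
  `dualCert_threeQuarter_near_eventually`, whose hypotheses are unsatisfiable (`…Fibre3TwoHoleBSPerron.near_inf_hpos_false`).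
Prover seat `hubbard-h0-rotor-p2` g3; helper for stmt-HubbardSuperconductivity-19089 (`--supports`, helper class).
WHAT THIS IS NOT: nothing here proves superconductivity in the Hubbard model; the rotor TARGET as originally worded stays
FALSE (g15 verdict).  One near pair class `d` (disjoint crosses) at a time, past a non-explicit (and, with these constants,
astronomically large) `L₀`; the three skeleton facts per `d`, the overlapping-cross pairs, far pairs and small `L` remain.
Mathlib + tree imports only; no sorry, no axioms.
-/

set_option linter.dupNamespace false

noncomputable section

open scoped BigOperators
open Complex Finset

namespace Summit.HubbardSuperconductivity.HubbardSuperconductivity.Theorems.AnisotropyChord.Transfer.Fibre3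

namespace TwoHoleBS

variable (L : ℕ) [NeZero L]

open Filter Topology in
/-- `(1 + log M)²/M → 0`. [folklore] -/
theorem tendsto_one_add_log_sq_div : Tendsto (fun M : ℕ => (1 + Real.log M) ^ 2 / (M : ℝ)) atTop (𝓝 0) := by
  have h2 : Tendsto (fun x : ℝ => Real.log x ^ 2 / x) atTop (𝓝 0) := by
    have := Real.tendsto_pow_log_div_mul_add_atTop 1 0 2 one_ne_zero
    simpa using this
  have h1 : Tendsto (fun x : ℝ => Real.log x / x) atTop (𝓝 0) := by
    have := Real.tendsto_pow_log_div_mul_add_atTop 1 0 1 one_ne_zero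
    simpa using this
  have h0 : Tendsto (fun x : ℝ => 1 / x) atTop (𝓝 0) := tendsto_const_nhds.div_atTop tendsto_id
  have key := ((h2.add (h1.const_mul 2)).add h0).comp tendsto_natCast_atTop_atTop
  simp only [mul_zero, add_zero] at key
  refine key.congr' ?_
  filter_upwards [Filter.eventually_gt_atTop 0] with M hM
  have hMr : (0 : ℝ) < M := by exact_mod_cast hM
  simp only [Function.comp_apply]
  field_simp
  ring

open Filter Topology in
/-- the error coefficient times the capacity scale tends to zero: `ε(M,d)·(1 + log M) → 0`. [folklore] -/
theorem tendsto_errCoeff_mul_log (d : ℤ × ℤ) :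
    Tendsto (fun M : ℕ => (2 * (rhoMax d * (11.71 * Real.log M + 5.9) / (M : ℝ) ^ 2)
      + 4 * (((15 / 2 * (Real.pi ^ 2 / 2 + Real.pi ^ 4 / 4) + 3 * Real.pi ^ 2 / 16)) * rhoMax d) / M)
        * (1 + Real.log M)) atTop (𝓝 0) := by
  set C₀ := (15 / 2 * (Real.pi ^ 2 / 2 + Real.pi ^ 4 / 4) + 3 * Real.pi ^ 2 / 16) with hC₀
  set Cd := 2 * rhoMax d * (11.71 + 5.9) + 4 * (C₀ * rhoMax d) with hCd
  have hρ := rhoMax_nonneg d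
  have hC0 : 0 ≤ C₀ := by positivity
  -- domination by `Cd·(1 + log M)²/M` for `M ≥ 1`
  have hdom : ∀ M : ℕ, 1 ≤ M →
      |(2 * (rhoMax d * (11.71 * Real.log M + 5.9) / (M : ℝ) ^ 2) + 4 * (C₀ * rhoMax d) / M) * (1 + Real.log M)|
        ≤ Cd * ((1 + Real.log M) ^ 2 / (M : ℝ)) := by
    intro M hM
    have hMr : (1 : ℝ) ≤ M := by exact_mod_cast hM
    have hlog : 0 ≤ Real.log M := Real.log_nonneg hMr
    have hpos : 0 ≤ (2 * (rhoMax d * (11.71 * Real.log M + 5.9) / (M : ℝ) ^ 2) + 4 * (C₀ * rhoMax d) / M) := by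
      positivity
    rw [abs_of_nonneg (mul_nonneg hpos (by positivity))]
    -- `1/M² ≤ 1/M`, `log M ≤ 1 + log M`, `1 ≤ 1 + log M`
    have hM2 : 1 / (M : ℝ) ^ 2 ≤ 1 / (M : ℝ) := by
      rw [div_le_div_iff₀ (by positivity) (by positivity)]; nlinarith
    have t1 : rhoMax d * (11.71 * Real.log M + 5.9) / (M : ℝ) ^ 2
        ≤ rhoMax d * (11.71 + 5.9) * (1 + Real.log M) / M := by
      have a1 : rhoMax d * (11.71 * Real.log M + 5.9) ≤ rhoMax d * (11.71 + 5.9) * (1 + Real.log M) := by nlinarith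
      calc rhoMax d * (11.71 * Real.log M + 5.9) / (M : ℝ) ^ 2
          = rhoMax d * (11.71 * Real.log M + 5.9) * (1 / (M : ℝ) ^ 2) := by ring
        _ ≤ rhoMax d * (11.71 + 5.9) * (1 + Real.log M) * (1 / (M : ℝ)) :=
            mul_le_mul a1 hM2 (by positivity) (by positivity)
        _ = _ := by ring
    have t2 : 4 * (C₀ * rhoMax d) / (M : ℝ) ≤ 4 * (C₀ * rhoMax d) * (1 + Real.log M) / M := by
      rw [div_le_div_iff_of_pos_right (by positivity)]
      nlinarith [mul_nonneg hC0 hρ]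
    calc (2 * (rhoMax d * (11.71 * Real.log M + 5.9) / (M : ℝ) ^ 2) + 4 * (C₀ * rhoMax d) / M) * (1 + Real.log M)
        ≤ (2 * (rhoMax d * (11.71 + 5.9) * (1 + Real.log M) / M) + 4 * (C₀ * rhoMax d) * (1 + Real.log M) / M)
            * (1 + Real.log M) := by
          refine mul_le_mul_of_nonneg_right ?_ (by positivity)
          linarith
      _ = Cd * ((1 + Real.log M) ^ 2 / (M : ℝ)) := by rw [hCd]; ring
  have hlim : Tendsto (fun M : ℕ => Cd * ((1 + Real.log M) ^ 2 / (M : ℝ))) atTop (𝓝 0) := by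
    have := tendsto_one_add_log_sq_div.const_mul Cd
    simpa using this
  refine squeeze_zero_norm' ?_ hlim
  filter_upwards [Filter.eventually_ge_atTop 1] with M hM
  exact hdom M hM

/-- ★★★ **NEAR-PAIR HOLE₂(.75) FOR ALL LARGE `L` — HONEST FORM:** for an offset `d` with `|d|₁ ≥ 2`, if the explicit ℤ²
skeleton `skelA d` is invertible, `s > 0`, and `P∞ ≥ g` on zero-sum boundary vectors for some `g > 0` (three `L`-free facts,
all satisfiable — cf. `near_inf_hpos_false` for the earlier unsatisfiable form), then there is an `L₀` with
`DualCert L (¾ε₁) z (z + d)` for every `L ≥ L₀` and every `z`.  (Margin `m(4H_{⌊L/2⌋}) ≳ c/ln L` against an error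
`ε(L,d)·K = O(1/L)`.) [folklore] -/
theorem dualCert_threeQuarter_near_eventually_of_gap (d : ℤ × ℤ) (hd : 2 ≤ |d.1| + |d.2|)
    (hA : IsUnit (skelA d).det) (hs : 0 < TwoChannel.svec2 (skelA d)) (g : ℝ) (hg : 0 < g)
    (hgap : ∀ w : Fin 4 ⊕ Fin 4 → ℝ, ∑ i, w i = 0 →
      g * dotProduct w w ≤ dotProduct w ((twoHolePinf (skelA d)).mulVec w)) :
    ∃ L₀ : ℕ, ∀ (M : ℕ) [NeZero M], L₀ ≤ M → ∀ z : Tor M, DualCert M (3 / 4 * eps1 M) z (z + castPt M d) := by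
  set s := TwoChannel.svec2 (skelA d) with hsdef
  set xx := xBsq (skelA d) with hxxdef
  set K := Kinf (skelA d) with hKdef
  have hxx : 0 ≤ xx := by rw [hxxdef]; unfold xBsq; positivity
  have hK : 0 ≤ K := by rw [hKdef]; unfold Kinf; positivity
  -- target constant: `ε(M,d)·(1 + log M) ≤ c₁ := g/(32(g + xx/s)(K + 1))`
  set c₁ := g / (32 * (g + xx / s) * (K + 1)) with hc₁
  have hc₁pos : 0 < c₁ := by positivity
  obtain ⟨N₁, hN₁⟩ := Filter.eventually_atTop.mp ((tendsto_errCoeff_mul_log d).eventually (Iic_mem_nhds hc₁pos))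
  set N₂ : ℕ := 2 * ⌈Real.exp (1 / (2 * s))⌉₊ with hN₂
  refine ⟨max 8 (max N₁ N₂), fun M _ hM z => ?_⟩
  have h8 : 8 ≤ M := le_trans (le_max_left _ _) hM
  have hM1 : N₁ ≤ M := le_trans ((le_max_left _ _).trans (le_max_right _ _)) hM
  have hM2 : N₂ ≤ M := le_trans ((le_max_right _ _).trans (le_max_right _ _)) hM
  have hMr : (1 : ℝ) ≤ M := by exact_mod_cast (show 1 ≤ M by omega)
  have hlogM : 0 ≤ Real.log M := Real.log_nonneg hMr
  -- capacity threshold `2 ≤ 4H_{⌊M/2⌋}·s` (as in `dualCert_threeQuarter_near_eventually`)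
  have hH2 : 2 ≤ 4 * (harmonic (M / 2) : ℝ) * s := by
    have hdiv : ⌈Real.exp (1 / (2 * s))⌉₊ ≤ M / 2 := by
      rw [Nat.le_div_iff_mul_le two_pos]; omega
    have hH : 1 / (2 * s) ≤ (harmonic (M / 2) : ℝ) := by
      have hh := log_add_one_le_harmonic (M / 2)
      have hc : Real.exp (1 / (2 * s)) ≤ ((M / 2 + 1 : ℕ) : ℝ) := by
        have h1 := Nat.le_ceil (Real.exp (1 / (2 * s)))
        have h2 : (⌈Real.exp (1 / (2 * s))⌉₊ : ℝ) ≤ ((M / 2 : ℕ) : ℝ) := by exact_mod_cast hdiv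
        push_cast; linarith
      calc 1 / (2 * s) = Real.log (Real.exp (1 / (2 * s))) := (Real.log_exp _).symm
        _ ≤ Real.log ((M / 2 + 1 : ℕ) : ℝ) := Real.log_le_log (Real.exp_pos _) hc
        _ ≤ harmonic (M / 2) := hh
    calc (2 : ℝ) = 1 / (2 * s) * (4 * s) := by field_simp; ring
      _ ≤ (harmonic (M / 2) : ℝ) * (4 * s) := mul_le_mul_of_nonneg_right hH (by positivity)
      _ = 4 * (harmonic (M / 2) : ℝ) * s := by ring
  -- the capacity scale: `4H_{⌊M/2⌋} ≤ 4(1 + log M)`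
  have hHlog : 4 * (harmonic (M / 2) : ℝ) ≤ 4 * (1 + Real.log M) := by
    have h1 := harmonic_le_one_add_log (M / 2)
    have h2 : Real.log ((M / 2 : ℕ) : ℝ) ≤ Real.log M := by
      have : (1 : ℝ) ≤ ((M / 2 : ℕ) : ℝ) := by exact_mod_cast (show 1 ≤ M / 2 by omega)
      exact Real.log_le_log (by linarith) (by exact_mod_cast Nat.div_le_self M 2)
    linarith
  have hΛpos : 0 < 4 * (harmonic (M / 2) : ℝ) := by nlinarith
  -- threshold inequality `ε·K ≤ m(4H)`
  have hεlog : (2 * (rhoMax d * (11.71 * Real.log M + 5.9) / (M : ℝ) ^ 2)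
      + 4 * (((15 / 2 * (Real.pi ^ 2 / 2 + Real.pi ^ 4 / 4) + 3 * Real.pi ^ 2 / 16)) * rhoMax d) / M)
        * (1 + Real.log M) ≤ c₁ := hN₁ M hM1
  have hε := (errCoeff_pos M h8 d).le
  refine dualCert_threeQuarter_near_of_gap M h8 z d hd hA hs g hg hgap (4 * (harmonic (M / 2) : ℝ)) le_rfl hH2 ?_
  refine le_trans ?_ (liftMargin_ge g s xx _ hg hs hxx hH2)
  -- `ε·K ≤ ε(K+1) ≤ c₁(K+1)/(1+log M) ≤ g/(32(g+xx/s)(1+log M)) ≤ g/(8·4H·(g+xx/s))`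
  have hlog1 : 0 < 1 + Real.log M := by linarith
  have step1 : (2 * (rhoMax d * (11.71 * Real.log M + 5.9) / (M : ℝ) ^ 2)
        + 4 * (((15 / 2 * (Real.pi ^ 2 / 2 + Real.pi ^ 4 / 4) + 3 * Real.pi ^ 2 / 16)) * rhoMax d) / M) * K
      ≤ c₁ / (1 + Real.log M) * (K + 1) := by
    have a : (2 * (rhoMax d * (11.71 * Real.log M + 5.9) / (M : ℝ) ^ 2)
        + 4 * (((15 / 2 * (Real.pi ^ 2 / 2 + Real.pi ^ 4 / 4) + 3 * Real.pi ^ 2 / 16)) * rhoMax d) / M)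
        ≤ c₁ / (1 + Real.log M) := by
      rw [le_div_iff₀ hlog1]; exact hεlog
    calc _ ≤ (2 * (rhoMax d * (11.71 * Real.log M + 5.9) / (M : ℝ) ^ 2)
          + 4 * (((15 / 2 * (Real.pi ^ 2 / 2 + Real.pi ^ 4 / 4) + 3 * Real.pi ^ 2 / 16)) * rhoMax d) / M) * (K + 1) :=
          mul_le_mul_of_nonneg_left (by linarith) hε
      _ ≤ _ := mul_le_mul_of_nonneg_right a (by linarith)
  refine step1.trans ?_
  rw [hc₁]
  have hgx : 0 < g + xx / s := by positivity
  have hK1 : (K + 1) ≠ 0 := by positivity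
  have e : g / (32 * (g + xx / s) * (K + 1)) / (1 + Real.log M) * (K + 1)
      = g / (32 * (g + xx / s) * (1 + Real.log M)) := by
    field_simp
  rw [e]
  refine div_le_div_of_nonneg_left hg.le (by positivity) ?_
  nlinarith


end TwoHoleBS

end Summit.HubbardSuperconductivity.HubbardSuperconductivity.Theorems.AnisotropyChord.Transfer.Fibre3

end
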